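import Literature.Probability.HeavyTails.RenewalMeasureLowerBound
import Literature.Probability.HeavyTails.RenewalMeasureLinearUpperBound
import HarnessLib

/-!
# The elementary renewal theorem `U(-x, 0]/x → 1/m` for nonpositive steps

Topic `Literature/Probability/HeavyTails` (theorems only, no definitions, no named facts).

Sources (held). W. Feller, *An Introduction to Probability Theory and Its Applications* II
(Wiley 1971), Ch. XI §3, verbatim (after Theorem 1, (3.1)): "The renewal theorem itself states
only that `U(t) ∼ t/μ`" (`U = Σ_{n ≥ 0} F^{n★}` the renewal measure of a distribution `F` on
`[0, ∞)` with expectation `μ`, Ch. XI §1). S. Foss, D. Korshunov, S. Zachary, *An Introduction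
to Heavy-Tailed and Subexponential Distributions* (Springer 2011), §5.4–§5.5: Theorem 5.8
("`H_-(-x, 0] ≥ px/a`", and its local forms "particular cases of the key renewal theorem, see
Feller [26]") and the proof of Lemma 5.9 ("there exists `c` such that, for all `t > 0`,
`H_-(-t, 0] ≤ c + (p/a + ε) t`"), for the renewal measure of the weak descending ladder heights
(mean `-a/p`).

PROVED here, in the mirror-image convention of those files (steps `≤ 0`): for a probability
measure `G` on `ℝ` carried by `(-∞, 0]` with finite mean `∫ y G(dy) = -m < 0` and
`U = Σ_{k ≥ 0} G^{*k}` (`G^{*k} = (G ∗ ·)^[k] δ_0`):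

* `tsum_convIter_Ioc_lt_top` — `U(-x, 0] < ∞` for every `x ≥ 0`;
* **`tendsto_tsum_convIter_Ioc_toReal_div`** — **the elementary renewal theorem**:
  `U(-x, 0]/x → 1/m` as `x → ∞`.

Assembly of `RenewalMeasureLowerBound.ofReal_div_le_tsum_convIter_Ioc` (`U(-x, 0] ≥ x/m`) and
`RenewalMeasureLinearUpperBound.exists_tsum_convIter_Ioc_toReal_le_linear`
(`U(-x, 0] ≤ C + (1/m + ε) x`).

## References

* W. Feller, *An Introduction to Probability Theory and Its Applications*, Vol. II, 2nd ed.,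
  Wiley 1971, Ch. XI §1, §3 (remark after (3.1)). [cite: Feller1971]
* S. Foss, D. Korshunov, S. Zachary, *An Introduction to Heavy-Tailed and Subexponential
  Distributions*, Springer 2011, §5.4 Theorem 5.8, §5.5 Lemma 5.9 (proof).
  [cite: FossKorshunovZachary2011]
-/

noncomputable section

open MeasureTheory ProbabilityTheory Filter Set
open scoped Topology ENNReal

namespace Literature.Probability.HeavyTails.RenewalUpperBound

/-- The renewal measure of nonpositive steps with negative mean is finite on `(-x, 0]`
("`U(x) < ∞` for all `x`"). [cite: Feller1971, Ch. XI §1 (Lemma)] -/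
theorem tsum_convIter_Ioc_lt_top (G : Measure ℝ) [IsProbabilityMeasure G]
    (hG0 : G (Ioi 0) = 0) (hGi : Integrable (fun y : ℝ => y) G) (hneg : ∫ y, y ∂G < 0)
    {x : ℝ} (hx : 0 ≤ x) :
    ∑' k : ℕ, ((fun ρ : Measure ℝ => G ∗ ρ)^[k] (Measure.dirac 0)) (Ioc (-x) 0) < ⊤ := by
  -- the truncated bound with a level `n` for which `m_n > 0`
  have hm : 0 < -∫ y, y ∂G := neg_pos.2 hneg
  have hGae : ∀ᵐ y ∂G, y ≤ 0 := by
    rw [ae_iff]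
    simp only [not_le]
    exact hG0
  have hfn : ∀ n : ℕ, Integrable (fun y : ℝ => min (-y) (n : ℝ)) G := by
    intro n
    refine Integrable.mono' hGi.neg (measurable_neg.min measurable_const).aestronglyMeasurable ?_
    filter_upwards [hGae] with y hy
    rw [Real.norm_eq_abs, abs_of_nonneg (le_min (neg_nonneg.2 hy) (Nat.cast_nonneg n))]
    exact min_le_left _ _
  have hlim : Tendsto (fun n : ℕ => ∫ y, min (-y) (n : ℝ) ∂G) atTop (𝓝 (∫ y, -y ∂G)) := by
    refine integral_tendsto_of_tendsto_of_monotone hfn hGi.neg ?_ ?_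
    · exact Eventually.of_forall fun y n n' hnn' =>
        min_le_min_left _ (Nat.cast_le.2 hnn')
    · refine Eventually.of_forall fun y => ?_
      refine tendsto_atTop_of_eventually_const (i₀ := ⌈-y⌉₊) fun n hn => ?_
      exact min_eq_left ((Nat.le_ceil (-y)).trans (Nat.cast_le.2 hn))
  rw [integral_neg] at hlim
  obtain ⟨n, hn⟩ := (hlim.eventually (lt_mem_nhds hm)).exists
  exact lt_of_le_of_lt (tsum_convIter_Ioc_le_ofReal G hG0 hn hx) ENNReal.ofReal_lt_top

/-- **The elementary renewal theorem** ("the renewal theorem itself states only that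
`U(t) ∼ t/μ`"), for nonpositive steps: if `G` is a probability measure on `ℝ` carried by
`(-∞, 0]` with finite mean `∫ y G(dy) = -m < 0`, then
`Σ_{k ≥ 0} G^{*k}(-x, 0] / x → 1/m` as `x → ∞`.
[cite: Feller1971, Ch. XI §3 (remark after (3.1))]
[cite: FossKorshunovZachary2011, §5.4 Theorem 5.8 and §5.5 Lemma 5.9 (proof)] -/
theorem tendsto_tsum_convIter_Ioc_toReal_div (G : Measure ℝ) [IsProbabilityMeasure G]
    (hG0 : G (Ioi 0) = 0) (hGi : Integrable (fun y : ℝ => y) G) (hneg : ∫ y, y ∂G < 0) :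
    Tendsto (fun x : ℝ =>
      (∑' k : ℕ, ((fun ρ : Measure ℝ => G ∗ ρ)^[k] (Measure.dirac 0)) (Ioc (-x) 0)).toReal / x)
      atTop (𝓝 (1 / (-∫ y, y ∂G))) := by
  have hm : 0 < -∫ y, y ∂G := neg_pos.2 hneg
  -- lower bound `x/m ≤ U(-x, 0]`
  have hlow : ∀ x, 0 ≤ x → x / (-∫ y, y ∂G) ≤
      (∑' k : ℕ, ((fun ρ : Measure ℝ => G ∗ ρ)^[k] (Measure.dirac 0)) (Ioc (-x) 0)).toReal :=
    fun x hx => (ENNReal.ofReal_le_iff_le_toReal (tsum_convIter_Ioc_lt_top G hG0 hGi hneg hx).ne).1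
      (RenewalLowerBound.ofReal_div_le_tsum_convIter_Ioc G hG0 hGi hneg x)
  rw [tendsto_order]
  constructor
  · intro a ha
    filter_upwards [eventually_gt_atTop 0] with x hx
    have h := hlow x hx.le
    calc a < 1 / (-∫ y, y ∂G) := ha
      _ = x / (-∫ y, y ∂G) / x := by field_simp
      _ ≤ _ := div_le_div_of_nonneg_right h hx.le
  · intro b hb
    obtain ⟨C, hC⟩ := exists_tsum_convIter_Ioc_toReal_le_linear G hG0 hGi hneg
      (show 0 < (b - 1 / (-∫ y, y ∂G)) / 2 by linarith)
    have hCpos : 0 < max C 1 := lt_of_lt_of_le one_pos (le_max_right _ _)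
    filter_upwards [eventually_gt_atTop 0,
      eventually_gt_atTop (max C 1 / ((b - 1 / (-∫ y, y ∂G)) / 2))] with x hx hxC
    have h := hC x hx.le
    have hε : 0 < (b - 1 / (-∫ y, y ∂G)) / 2 := by linarith
    have h1 : max C 1 / x < (b - 1 / (-∫ y, y ∂G)) / 2 := by
      rw [div_lt_iff₀ hx]
      rw [div_lt_iff₀ hε] at hxC
      linarith [mul_comm x ((b - 1 / (-∫ y, y ∂G)) / 2)]
    calc (∑' k : ℕ, ((fun ρ : Measure ℝ => G ∗ ρ)^[k] (Measure.dirac 0)) (Ioc (-x) 0)).toReal / x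
        ≤ (C + (1 / (-∫ y, y ∂G) + (b - 1 / (-∫ y, y ∂G)) / 2) * x) / x :=
          div_le_div_of_nonneg_right h hx.le
      _ = C / x + (1 / (-∫ y, y ∂G) + (b - 1 / (-∫ y, y ∂G)) / 2) := by
          field_simp
      _ ≤ max C 1 / x + (1 / (-∫ y, y ∂G) + (b - 1 / (-∫ y, y ∂G)) / 2) := by
          gcongr
          exact le_max_left _ _
      _ < b := by linarith

end Literature.Probability.HeavyTails.RenewalUpperBound
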